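import Summits.AtomisticToContinuum.Crystallization.Theorems.ChargedEnergyGap.Negative.FarCopies

/-!
# `ChargedEnergyGap` (stmt-AtomisticToContinuum-14231), negative side II: the boundary allowance is not load-bearing

`ChargedEnergyGap ↔ ∃ κ > 0, ∀ N y, N·e* + κ·#charged ≤ E_LJ(y)` (amplification by far copies),
the dimer bound `e* + κ ≤ −1/24`, the certified ceiling `κ ≤ −1/24 − e*`, the hidden dependence
`ChargedEnergyGap → BddBelow (range e)` (item 0714), monotonicity, the kill criteria, and the
immateriality of the exponent `2/3` (any `α < 1`).  All `[folklore]`.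
-/

noncomputable section

namespace Summit.AtomisticToContinuum.Crystallization.Theorems.ChargedEnergyGapNegative

open Literature.MathematicalPhysics.StatisticalMechanics
open Literature.Geometry.DiscreteGeometry
open Summit.AtomisticToContinuum.Crystallization.Theses.PricedLinkCensus
open scoped BigOperators

/-! ## §3. The no-boundary reduction and its corollaries -/

section NoBoundaryReduction

/-- `((m³)·x)^(2/3) = m²·x^(2/3)` for `m, x ≥ 0`. [folklore] -/
theorem cube_mul_rpow {m x : ℝ} (hm : 0 ≤ m) (hx : 0 ≤ x) :
    ((m ^ 3) * x) ^ (2 / 3 : ℝ) = m ^ 2 * x ^ (2 / 3 : ℝ) := by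
  rw [Real.mul_rpow (pow_nonneg hm 3) hx]
  congr 1
  rw [show (m ^ 3) = m ^ (3 : ℝ) by norm_cast, ← Real.rpow_mul hm,
    show (3 : ℝ) * (2 / 3) = 2 by norm_num, Real.rpow_two]

/-- In `Fin N` with `N ≥ 2` every index has another one. [folklore] -/
theorem exists_ne_of_two_le {N : ℕ} (hN : 2 ≤ N) (i : Fin N) : ∃ j : Fin N, j ≠ i := by
  by_cases hi : (i : ℕ) = 0
  · exact ⟨⟨1, by omega⟩, fun h => by rw [Fin.ext_iff] at h; simp at h; omega⟩
  · exact ⟨⟨0, by omega⟩, fun h => hi (by rw [← h])⟩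

/-- **Amplification by far copies** (`N ≥ 2`): a priced gap with ANY boundary allowance `C`
forces the allowance-free inequality `N·e* + κ·#charged(y) ≤ E(y)` for every injective `y`.
Proof: apply the gap to `M = m³` far translated copies of `y` (charged count `× M`, energy
`≤ M·E(y)`, `C·(MN)^(2/3)/M → 0`). [folklore] -/
theorem noBoundaryAt_of_gapWith {η κ C : ℝ} (hη1 : η ≤ 1) (h : GapWith η κ C) {N : ℕ}
    (hN : 2 ≤ N) (y : Fin N → E3) (hy : Function.Injective y) :
    (N : ℝ) * eStar + κ * (charged η y : ℝ) ≤ interactionEnergy lennardJones y := by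
  have hN' : ∀ i : Fin N, ∃ j, j ≠ i := exists_ne_of_two_le hN
  have key : ∀ M : ℕ, ((M : ℝ) * N) * eStar + κ * ((M : ℝ) * charged η y) -
      C * ((M : ℝ) * N) ^ (2 / 3 : ℝ) ≤ (M : ℝ) * interactionEnergy lennardJones y := by
    intro M
    have hg := h (M * N) (copiesFin M (spacing y) y)
      (copiesFin_injective M (two_Dsum_lt_spacing y) hy)
    rw [charged_copiesFin M hη1 y hN'] at hg
    push_cast at hg
    exact hg.trans (interactionEnergy_copiesFin_le M y (one_le_spacing_sub y))
  refine le_of_not_gt fun hlt => ?_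
  have hε0 : 0 < (N : ℝ) * eStar + κ * (charged η y : ℝ) - interactionEnergy lennardJones y := by
    linarith
  obtain ⟨m₀, hm₀⟩ := exists_nat_gt (C * (N : ℝ) ^ (2 / 3 : ℝ) /
    ((N : ℝ) * eStar + κ * (charged η y : ℝ) - interactionEnergy lennardJones y))
  have hm1 : C * (N : ℝ) ^ (2 / 3 : ℝ) < ((m₀ + 1 : ℕ) : ℝ) *
      ((N : ℝ) * eStar + κ * (charged η y : ℝ) - interactionEnergy lennardJones y) := by
    rw [div_lt_iff₀ hε0] at hm₀
    push_cast
    nlinarith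
  have hm2 : (0 : ℝ) < (((m₀ + 1 : ℕ) : ℝ)) ^ 2 := by positivity
  have hkey := key ((m₀ + 1) ^ 3)
  push_cast [Nat.cast_pow] at hkey
  push_cast at hm1 hm2
  rw [cube_mul_rpow (by positivity) (Nat.cast_nonneg N)] at hkey
  nlinarith [mul_lt_mul_of_pos_right hm1 hm2, hkey]

/-- The unit dimer `{0, e₀}`. [folklore] -/
def dimer : Fin 2 → E3 := ![0, e0]

/-- `e₀ ≠ 0`. [folklore] -/
theorem e0_ne_zero : e0 ≠ 0 := by
  intro h
  have := norm_e0
  rw [h, norm_zero] at this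
  norm_num at this

/-- The dimer consists of two distinct points. [folklore] -/
theorem dimer_injective : Function.Injective dimer := by
  intro i j h
  fin_cases i <;> fin_cases j <;> simp_all [dimer, e0_ne_zero, e0_ne_zero.symm]

/-- First point of the dimer. [folklore] -/
@[simp] theorem dimer_zero : dimer 0 = 0 := rfl

/-- Second point of the dimer. [folklore] -/
@[simp] theorem dimer_one : dimer 1 = e0 := rfl

/-- `E(dimer) = V_LJ(1) = −1/12`. [folklore] -/
theorem interactionEnergy_dimer : interactionEnergy lennardJones dimer = -1 / 12 := by
  have h2 := two_mul_interactionEnergy_eq_sum_sum lennardJones lennardJones_zero dimer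
  simp only [Fin.sum_univ_two, dimer_zero, dimer_one,
    dist_self, lennardJones_zero, dist_zero_left, dist_zero_right, norm_e0, norm_zero,
    lennardJones_one] at h2
  linarith

/-- **The dimer bound**: a priced gap at tolerance `η ≤ 1` forces `e* + κ ≤ −1/24`
(`N·e* + κ·#charged ≤ E` at the dimer: both sites charged, `E = −1/12`). In particular every
admissible price satisfies `κ ≤ −1/24 − e*` (≈ 0.676 numerically) and `e* < −1/24`. [folklore] -/
theorem eStar_add_le_of_gapWith {η κ C : ℝ} (hη1 : η ≤ 1) (h : GapWith η κ C) :
    eStar + κ ≤ -1 / 24 := by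
  have := noBoundaryAt_of_gapWith hη1 h le_rfl dimer dimer_injective
  rw [charged_eq_of_le (by norm_num) dimer, interactionEnergy_dimer] at this
  push_cast at this
  linarith

/-- **No-boundary reduction**: `GapWith η κ C → NoBoundary η κ` (`η ≤ 1`; all `N`, the cases
`N = 0, 1` directly). [folklore] -/
theorem noBoundary_of_gapWith {η κ C : ℝ} (hη1 : η ≤ 1) (h : GapWith η κ C) :
    NoBoundary η κ := by
  intro N y hy
  rcases Nat.lt_or_ge N 2 with hN | hN
  · interval_cases N
    · rw [charged_zero, interactionEnergy_of_subsingleton]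
      simp
    · rw [charged_eq_of_le (by norm_num) y, interactionEnergy_of_subsingleton]
      push_cast
      linarith [eStar_add_le_of_gapWith hη1 h]
  · exact noBoundaryAt_of_gapWith hη1 h hN y hy

/-- Conversely the allowance-free inequality is the gap with `C = 0`. [folklore] -/
theorem gapWith_of_noBoundary {η κ : ℝ} (h : NoBoundary η κ) : GapWith η κ 0 := by
  intro N y hy
  have := h N y hy
  simpa using this

/-- **`ChargedEnergyGap ↔ ∃ κ > 0, NoBoundary (1/100) κ`**: the boundary allowance
`−C·N^(2/3)` carries no content. [folklore] -/
theorem chargedEnergyGap_iff_noBoundary :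
    ChargedEnergyGap ↔ ∃ κ : ℝ, 0 < κ ∧ NoBoundary (1 / 100) κ := by
  rw [chargedEnergyGap_iff]
  constructor
  · rintro ⟨κ, C, hκ, h⟩
    exact ⟨κ, hκ, noBoundary_of_gapWith (by norm_num) h⟩
  · rintro ⟨κ, hκ, h⟩
    exact ⟨κ, 0, hκ, gapWith_of_noBoundary h⟩

/-- **Hidden dependence on item 0714 (`CrysPeriodicBddBelow`)**: the crux forces `e* < −1/24`,
hence the periodic energies per particle ARE bounded below (otherwise `⨅ = 0` is Lean's junk
value); any proof of the crux proves item 0714 on the way. [folklore] -/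
theorem eStar_lt_of_chargedEnergyGap (h : ChargedEnergyGap) : eStar < -1 / 24 := by
  obtain ⟨κ, C, hκ, hg⟩ := chargedEnergyGap_iff.1 h
  linarith [eStar_add_le_of_gapWith (by norm_num : (1 / 100 : ℝ) ≤ 1) hg]

/-- **The crux implies item 0714**: the Lennard-Jones energies per particle of periodic configurations are bounded below (else `e* = 0` is junk and the dimer bound fails). [folklore] -/
theorem bddBelow_of_chargedEnergyGap (h : ChargedEnergyGap) :
    BddBelow (Set.range fun Q : PeriodicConfiguration 3 => Q.energyPerParticle lennardJones) := by
  by_contra hb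
  have h0 : eStar = 0 := Real.iInf_of_not_bddBelow hb
  linarith [eStar_lt_of_chargedEnergyGap h]

/-- **Certified ceiling on the price**: every admissible `κ` satisfies `κ ≤ −1/24 − e*`. [folklore] -/
theorem kappa_le_of_gapWith {η κ C : ℝ} (hη1 : η ≤ 1) (h : GapWith η κ C) : κ ≤ -1 / 24 - eStar := by
  linarith [eStar_add_le_of_gapWith hη1 h]

/-- **Kill criterion (per price).** ONE injective configuration undercutting
`N·e* + κ·#charged` refutes the gap at price `κ` for EVERY boundary allowance `C`. [folklore] -/
theorem not_gapWith_of_witness {η κ : ℝ} (hη1 : η ≤ 1) {N : ℕ} {y : Fin N → E3}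
    (hy : Function.Injective y)
    (hlt : interactionEnergy lennardJones y < (N : ℝ) * eStar + κ * (charged η y : ℝ)) (C : ℝ) :
    ¬ GapWith η κ C := fun h =>
  absurd (noBoundary_of_gapWith hη1 h N y hy) (not_le.2 hlt)

/-- **Kill criterion (crux).** A family of injective configurations `y_κ` with
`E(y_κ) < N·e* + κ·#charged(y_κ)` for every `κ > 0` refutes `ChargedEnergyGap`. [folklore] -/
theorem not_chargedEnergyGap_of_cheap_charge
    (h : ∀ κ : ℝ, 0 < κ → ∃ (N : ℕ) (y : Fin N → E3), Function.Injective y ∧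
      interactionEnergy lennardJones y < (N : ℝ) * eStar + κ * (charged (1 / 100) y : ℝ)) :
    ¬ ChargedEnergyGap := by
  rw [chargedEnergyGap_iff_noBoundary]
  rintro ⟨κ, hκ, hnb⟩
  obtain ⟨N, y, hy, hlt⟩ := h κ hκ
  exact absurd (hnb N y hy) (not_le.2 hlt)

/-- Prices are monotone: a gap at price `κ` gives the gap at every smaller price `κ' ≤ κ`
(with the same allowance), since `#charged ≥ 0`. [folklore] -/
theorem gapWith_mono {η κ κ' C C' : ℝ} (hκ : κ' ≤ κ) (hC : C ≤ C') (h : GapWith η κ C) :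
    GapWith η κ' C' := by
  intro N y hy
  have := h N y hy
  have h1 : κ' * (charged η y : ℝ) ≤ κ * (charged η y : ℝ) :=
    mul_le_mul_of_nonneg_right hκ (Nat.cast_nonneg _)
  have h2 : C * (N : ℝ) ^ (2 / 3 : ℝ) ≤ C' * (N : ℝ) ^ (2 / 3 : ℝ) :=
    mul_le_mul_of_nonneg_right hC (Real.rpow_nonneg (Nat.cast_nonneg _) _)
  linarith

end NoBoundaryReduction

/-! ### §3b. Any sublinear power allowance `C·N^α`, `α < 1`, gives the same statement -/

section Exponent

/-- The crux inequality with a general power allowance `C·N^α`. [folklore] -/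
def GapWithExp (α η κ C : ℝ) : Prop :=
  ∀ (N : ℕ) (y : Fin N → E3), Function.Injective y →
    (N : ℝ) * eStar + κ * (charged η y : ℝ) - C * (N : ℝ) ^ α ≤ interactionEnergy lennardJones y

/-- `GapWith` is the case `α = 2/3` (by `Iff.rfl`). [folklore] -/
theorem gapWith_iff_gapWithExp (η κ C : ℝ) : GapWith η κ C ↔ GapWithExp (2 / 3) η κ C := Iff.rfl

/-- **Amplification for a general exponent `α < 1`** (`N ≥ 2`): `C·(MN)^α / M → 0`. [folklore] -/
theorem noBoundaryAt_of_gapWithExp {α η κ C : ℝ} (hα : α < 1) (hη1 : η ≤ 1)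
    (h : GapWithExp α η κ C) {N : ℕ} (hN : 2 ≤ N) (y : Fin N → E3) (hy : Function.Injective y) :
    (N : ℝ) * eStar + κ * (charged η y : ℝ) ≤ interactionEnergy lennardJones y := by
  have hN' : ∀ i : Fin N, ∃ j, j ≠ i := exists_ne_of_two_le hN
  have key : ∀ M : ℕ, ((M : ℝ) * N) * eStar + κ * ((M : ℝ) * charged η y) -
      C * ((M : ℝ) ^ α * (N : ℝ) ^ α) ≤ (M : ℝ) * interactionEnergy lennardJones y := by
    intro M
    have hg := h (M * N) (copiesFin M (spacing y) y)
      (copiesFin_injective M (two_Dsum_lt_spacing y) hy)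
    rw [charged_copiesFin M hη1 y hN'] at hg
    push_cast at hg
    rw [Real.mul_rpow (Nat.cast_nonneg M) (Nat.cast_nonneg N)] at hg
    exact hg.trans (interactionEnergy_copiesFin_le M y (one_le_spacing_sub y))
  refine le_of_not_gt fun hlt => ?_
  set ε := (N : ℝ) * eStar + κ * (charged η y : ℝ) - interactionEnergy lennardJones y with hε
  have hε0 : 0 < ε := by rw [hε]; linarith
  -- from `key`: `M·ε ≤ C·M^α·N^α` for every `M`
  have key' : ∀ M : ℕ, (M : ℝ) * ε ≤ C * ((M : ℝ) ^ α * (N : ℝ) ^ α) := fun M => by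
    have := key M; rw [hε]; linarith
  have hNα : (0 : ℝ) < (N : ℝ) ^ α := Real.rpow_pos_of_pos (by exact_mod_cast (by omega : 0 < N)) α
  -- `M = 1`: so `C·N^α ≥ ε > 0`, in particular `C > 0`
  have h1 := key' 1
  simp only [Nat.cast_one, one_mul, Real.one_rpow] at h1
  have hC : 0 < C := by
    by_contra hC; push Not at hC
    have : C * (N : ℝ) ^ α ≤ 0 := mul_nonpos_of_nonpos_of_nonneg hC hNα.le
    linarith
  -- large `M`: `M^(α-1) → 0`
  have ht : Filter.Tendsto (fun x : ℝ => x ^ (-(1 - α))) Filter.atTop (nhds 0) :=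
    tendsto_rpow_neg_atTop (by linarith)
  have hev : ∀ᶠ x : ℝ in Filter.atTop, x ^ (-(1 - α)) < ε / (C * (N : ℝ) ^ α) :=
    ht.eventually (gt_mem_nhds (by positivity))
  obtain ⟨x₀, hx₀⟩ := Filter.eventually_atTop.1 hev
  obtain ⟨M, hM⟩ := exists_nat_gt (max x₀ 1)
  have hM1 : (1 : ℝ) < M := lt_of_le_of_lt (le_max_right _ _) hM
  have hMx : x₀ ≤ (M : ℝ) := (le_max_left _ _).trans hM.le
  have hMpos : (0 : ℝ) < M := by linarith
  have hsmall := hx₀ M hMx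
  -- `M^α = M · M^(α-1)`
  have hsplit : (M : ℝ) ^ α = (M : ℝ) * (M : ℝ) ^ (-(1 - α)) := by
    rw [show -(1 - α) = α - 1 by ring, Real.rpow_sub_one hMpos.ne', mul_div_cancel₀ _ hMpos.ne']
  have h2 := key' M
  rw [hsplit] at h2
  -- `M ε ≤ C · M · M^(α-1) · N^α < M · ε`
  have h3 : C * ((M : ℝ) * (M : ℝ) ^ (-(1 - α)) * (N : ℝ) ^ α) < (M : ℝ) * ε := by
    have := mul_lt_mul_of_pos_left hsmall (mul_pos hMpos (mul_pos hC hNα))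
    have hsimp : (M : ℝ) * (C * (N : ℝ) ^ α) * (ε / (C * (N : ℝ) ^ α)) = (M : ℝ) * ε := by
      field_simp
    rw [hsimp] at this
    nlinarith
  linarith

/-- Hence the general-exponent gap also forces the dimer bound and the allowance-free form. [folklore] -/
theorem noBoundary_of_gapWithExp {α η κ C : ℝ} (hα : α < 1) (hη1 : η ≤ 1)
    (h : GapWithExp α η κ C) : NoBoundary η κ := by
  have hdimer : eStar + κ ≤ -1 / 24 := by
    have := noBoundaryAt_of_gapWithExp hα hη1 h le_rfl dimer dimer_injective
    rw [charged_eq_of_le (by norm_num) dimer, interactionEnergy_dimer] at this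
    push_cast at this
    linarith
  intro N y hy
  rcases Nat.lt_or_ge N 2 with hN | hN
  · interval_cases N
    · rw [charged_zero, interactionEnergy_of_subsingleton]
      simp
    · rw [charged_eq_of_le (by norm_num) y, interactionEnergy_of_subsingleton]
      push_cast
      linarith
  · exact noBoundaryAt_of_gapWithExp hα hη1 h hN y hy

/-- **The exponent `2/3` is immaterial**: for every `α < 1`,
`(∃ κ > 0, ∃ C, GapWithExp α (1/100) κ C) ↔ ChargedEnergyGap`. [folklore] -/
theorem chargedEnergyGap_iff_exp {α : ℝ} (hα : α < 1) :
    (∃ κ C : ℝ, 0 < κ ∧ GapWithExp α (1 / 100) κ C) ↔ ChargedEnergyGap := by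
  rw [chargedEnergyGap_iff_noBoundary]
  constructor
  · rintro ⟨κ, C, hκ, h⟩
    exact ⟨κ, hκ, noBoundary_of_gapWithExp hα (by norm_num) h⟩
  · rintro ⟨κ, hκ, h⟩
    refine ⟨κ, 0, hκ, fun N y hy => ?_⟩
    have := h N y hy
    simpa using this

end Exponent

end Summit.AtomisticToContinuum.Crystallization.Theorems.ChargedEnergyGapNegative

end
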